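/-
Copyright (c) 2026 the pub-hodgecm-mathlib formalisation cell (harness21).  Prover seat hodgecm-mathlib-F0P3-p01 (g30), «(D-RAM) FOUR-FRAME» road of crux H413
(tier-1 socket `U1_Frames`, stub `stub_U1_fourFrameData`, brick 1): FOUR-FRAME FAMILIES EXIST at every non-split CM place.  2026-09-03.
-/
import Literature.NumberTheory.Automorphic.LocalHermitianFormsRankThreeCongruence   -- ★ Jacobowitz rank 3, local coefficients: `exists_formCongr_eq_of_det_eq_mul_norm_three`
import Literature.NumberTheory.Automorphic.LocalHermitianFormSign                   -- ★ `exists_cm_delta` (a skew element of the CM field)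
import Literature.NumberTheory.LocalFields.QuadraticLocalNormDichotomy              -- ★ (J3) `IsCMField.exists_fixed_nonnorm_dichotomy` (a `σ_w`-fixed non-norm + index two)
import Literature.NumberTheory.Automorphic.AnisotropicUnitaryGroupCompactOfPlace    -- ★ `conjLocal_apply_eq_of_smul_eq` (`(c ⊗ 1) X` at `w` is `σ_w (X_w)`); brings ★ `PlacesOver.eq_of_smul_eq`
import Literature.NumberTheory.Automorphic.LocalUnitaryGroupCongr                   -- ★ `antidiagOne_eq_over` (the literal `Φ₃` is `(StdForm.antidiagonal 3).over`)
import Literature.NumberTheory.Automorphic.UnitaryThreeFourFrameDefs                -- ★ #0a (B-p04): `IsFourFrameFamily`, `normSign`, `signPair`, `pairing`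
import HarnessLib

/-!
# Four-frame families exist at every non-split CM place: for each sign pair `(ε₁, ε₂) ∈ {±1}²` a `Φ₃`-orthogonal frame of `L_w³` with norm classes
# `(ε₁, ε₂, ω(−1)ε₁ε₂)` (Jacobowitz's rank-3 classification + the local norm index two)

Topic `NumberTheory/Automorphic`; namespace `Literature.NumberTheory.Automorphic.UnitaryThreeFourFrame` (the namespace of ★ #0a `UnitaryThreeFourFrameDefs`).
THEOREMS ONLY (no `def`, no instance, no notation, no `sorry`, no named fact).  Cell `pub/hodgecm-mathlib` (D-0151), crux H413 = `stmt-HodgeConjecture-24833`,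
(D-RAM) «FOUR-FRAME» road, tier-1 socket `Cruxes/H413/Lines/F0_P3c_DyRamFourFrame_U1_Frames.lean`, stub `stub_U1_fourFrameData` (the G-side ∃-half of (D-CΔ)
`FourFrameTransferFactor`): its first ∃-witness is a four-frame family `f` with `IsFourFrameFamily σ_w f` (H7).  Every other file of the road takes `f` as a HYPOTHESIS;
this file proves that such an `f` EXISTS at every non-split place `w ∣ v` of a CM field `L ∕ L⁺` (no ramification or dyadic hypothesis is needed).

THE MATHEMATICS ([Jacobowitz1962, §3 Thm. 3.1]; [Rogawski1990, §3.6 pp. 31–32, §4.9 p. 55]).  `K = L_w`, `σ = σ_w`, `Φ₃ = antidiag(1,1,1)`, `det Φ₃ = −1`.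
By the local norm index theorem in `σ_w`-currency (★ (J3) `IsCMField.exists_fixed_nonnorm_dichotomy`) there is a `σ`-fixed `ε ≠ 0` which is not a norm `z·σz`, and every
`σ`-fixed `s ≠ 0` is a norm or `ε·s` is; hence the norm class sign `ω = normSign σ` (H1) is MULTIPLICATIVE on `σ`-fixed non-zero scalars (§1).  For a sign pair `(ε₁, ε₂)` put
`n₁, n₂ ∈ {1, ε}` with `ω(n_i) = ε_i` and `n₃ := −(n₁n₂)⁻¹`, so that `n₁n₂n₃ = −1 = det Φ₃` and `ω(n₃) = ω(−1)ε₁ε₂`.  The diagonal form `D = diag(n₁, n₂, n₃)` is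
`σ`-hermitian with `det D = det Φ₃`, so by JACOBOWITZ (★ `exists_formCongr_eq_of_det_eq_mul_norm_three`, ternary hermitian forms at a non-split place are classified by the
determinant modulo norms) `ᵗσ(T)·Φ₃·T = D` for some `T ∈ GL₃`; the columns of `T` are a `Φ₃`-orthogonal frame with norms `(n₁, n₂, n₃)` — a frame of index `b` (§3).  The ★
classification is typed over the semi-local ring `L ⊗ L⁺_v = Π_{w′ ∣ v} L_{w′}` with the conjugation `c ⊗ 1`; at a non-split place this ring has the single factor `L_w`
(★ `PlacesOver.eq_of_smul_eq`) and `c ⊗ 1` reads `σ_w` there (§2, the transport).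

* §1 `normSign` algebra: `normSign_one`, `normSign_of_isNorm ∕ _of_not_isNorm`, `normSign_inv_of_map_eq`, **`normSign_mul_of_dichotomy`**.
* §2 transport at a non-split place: `exists_localRing_apply_eq` ∕ `exists_localRing_apply_eq_of_map_eq` (lifting a (`σ_w`-fixed) scalar of `L_w` to a (`(c ⊗ 1)`-fixed)
  element of `Π_{w′} L_{w′}`), `localRing_eq_of_apply_eq`, `formCongr_antidiagOne_apply_apply` (the entries of `ᵗ(c⊗1)(T)·Φ₃·T` at `w` are the `Φ₃`-products of the
  columns of `T_w`; `(c ⊗ 1)X` at `w` is `σ_w(X_w)` by ★ `conjLocal_apply_eq_of_smul_eq`).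
* §3 **`exists_orthogonalFrame_of_map_eq`** (a `Φ₃`-orthogonal frame with prescribed `σ`-fixed norms `n₁, n₂` and third norm `−(n₁n₂)⁻¹`) and
  **`exists_isFourFrameFamily`** (H7 is inhabited at every non-split CM place).

HONEST LABEL: HC_CM is proved only modulo the 7 printed citations (2 remaining named inputs: hLiu418 = stmt-HodgeConjecture-24832, h413 = stmt-HodgeConjecture-24833) until
rung 0 closes; `--supports stmt-HodgeConjecture-24833` helper, count-neutral local algebra.

## References
* [Jacobowitz1962] R. Jacobowitz, *Hermitian forms over local fields*, Amer. J. Math. 84 (1962) 441–465, §3 Thm. 3.1.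
* [Rogawski1990] J. D. Rogawski, *Automorphic Representations of Unitary Groups in Three Variables*, Ann. of Math. Stud. 123 (1990), §3.6 pp. 31–32, §4.9 p. 55.
* [Serre1979] J.-P. Serre, *Local Fields*, GTM 67 (1979), Ch. XIV §3 (the local norm index).
-/

noncomputable section

open scoped Matrix MatrixGroups Classical
open NumberField IsDedekindDomain

namespace Literature.NumberTheory.Automorphic.UnitaryThreeFourFrame

open Literature.NumberTheory.Automorphic Literature.NumberTheory.Automorphic.UnitaryGroup Literature.NumberTheory.Automorphic.UnitaryLatticeTree

/-! ## §1  `normSign` algebra under the index-two dichotomy -/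

section NormSign

variable {K : Type} [Field K] (σ : K →+* K)

/-- `ω(x) = 1` for a norm `x = z·σz` (H1). [cite: Rogawski1990, §4.9 p. 55] -/
theorem normSign_of_isNorm {x : K} (h : ∃ z : K, z * σ z = x) : normSign σ x = 1 := by
  unfold normSign; rw [if_pos h]

/-- `ω(x) = −1` for a non-norm `x` (H1). [cite: Rogawski1990, §4.9 p. 55] -/
theorem normSign_of_not_isNorm {x : K} (h : ¬ ∃ z : K, z * σ z = x) : normSign σ x = -1 := by
  unfold normSign; rw [if_neg h]

/-- `ω(1) = 1`. [cite: Rogawski1990, §4.9 p. 55] -/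
theorem normSign_one : normSign σ (1 : K) = 1 :=
  normSign_of_isNorm σ ⟨1, by rw [map_one, mul_one]⟩

/-- Multiplying by a norm `σ(c)·c`, `c ≠ 0`, does not change `ω`. [cite: Rogawski1990, §4.9 p. 55] -/
private theorem normSign_norm_mul {c : K} (hc : c ≠ 0) (x : K) : normSign σ (c * σ c * x) = normSign σ x := by
  unfold normSign
  have hiff : (∃ z : K, z * σ z = c * σ c * x) ↔ ∃ z : K, z * σ z = x := by
    constructor
    · rintro ⟨z, hz⟩
      refine ⟨z / c, ?_⟩
      have hσc : σ c ≠ 0 := (map_ne_zero σ).2 hc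
      rw [map_div₀, div_mul_div_comm, hz]
      field_simp
    · rintro ⟨z, hz⟩
      exact ⟨c * z, by rw [map_mul, ← hz]; ring⟩
  rw [if_congr hiff rfl rfl]

/-- `ω(x⁻¹) = ω(x)` for `σ`-fixed `x ≠ 0` (`x⁻¹ = x⁻¹·σ(x⁻¹)·x`). [cite: Rogawski1990, §4.9 p. 55] -/
theorem normSign_inv_of_map_eq {x : K} (hx : σ x = x) (hx0 : x ≠ 0) : normSign σ x⁻¹ = normSign σ x := by
  have h : x⁻¹ = x⁻¹ * σ x⁻¹ * x := by rw [map_inv₀, hx, inv_mul_cancel_right₀ hx0]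
  rw [h, normSign_norm_mul σ (inv_ne_zero hx0)]

/-- **`ω` IS MULTIPLICATIVE ON `σ`-FIXED NON-ZERO SCALARS** under the index-two dichotomy of the local norm index theorem: if `ε` is `σ`-fixed, not a norm, and every
`σ`-fixed `s ≠ 0` is a norm or has `ε·s` a norm, then `ω(xy) = ω(x)ω(y)` for `σ`-fixed `x, y ≠ 0`.  [cite: Serre1979, Ch. XIV §3] [cite: Rogawski1990, §4.9 p. 55] -/
theorem normSign_mul_of_dichotomy {ε : K} (hσε : σ ε = ε) (hεn : ¬ ∃ z : K, z * σ z = ε)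
    (hdich : ∀ s : K, σ s = s → s ≠ 0 → (∃ z : K, z * σ z = s) ∨ ∃ z : K, z * σ z = ε * s)
    {x y : K} (hx : σ x = x) (hy : σ y = y) (hx0 : x ≠ 0) (hy0 : y ≠ 0) :
    normSign σ (x * y) = normSign σ x * normSign σ y := by
  have hε0 : ε ≠ 0 := fun h => hεn ⟨0, by rw [h, zero_mul]⟩
  by_cases hxN : ∃ z : K, z * σ z = x
  · obtain ⟨a, ha⟩ := hxN
    have ha0 : a ≠ 0 := fun h => hx0 (by rw [← ha, h, zero_mul])
    rw [normSign_of_isNorm σ ⟨a, ha⟩, one_mul, ← ha, normSign_norm_mul σ ha0]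
  · have hxs : normSign σ x = -1 := normSign_of_not_isNorm σ hxN
    obtain ⟨a, ha⟩ := (hdich x hx hx0).resolve_left hxN
    have ha0 : a ≠ 0 := fun h => mul_ne_zero hε0 hx0 (by rw [← ha, h, zero_mul])
    by_cases hyN : ∃ z : K, z * σ z = y
    · obtain ⟨b, hb⟩ := hyN
      have hb0 : b ≠ 0 := fun h => hy0 (by rw [← hb, h, zero_mul])
      rw [hxs, normSign_of_isNorm σ ⟨b, hb⟩, mul_comm x y, ← hb, normSign_norm_mul σ hb0, hxs, mul_one]
    · have hys : normSign σ y = -1 := normSign_of_not_isNorm σ hyN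
      obtain ⟨b, hb⟩ := (hdich y hy hy0).resolve_left hyN
      rw [hxs, hys]
      refine (normSign_of_isNorm σ ⟨a * b / ε, ?_⟩).trans (by norm_num)
      rw [map_div₀, map_mul, hσε, div_mul_div_comm, show a * b * (σ a * σ b) = (a * σ a) * (b * σ b) by ring, ha, hb]
      field_simp

end NormSign

/-! ## §2  Transport at a non-split place: the semi-local ring `Π_{w′ ∣ v} L_{w′}` has the single factor `L_w`, and `c ⊗ 1` reads `σ_w` -/

section CM

variable (L : Type) [Field L] [NumberField L] [IsCMField L] {v : HeightOneSpectrum (𝓞 ↥(maximalRealSubfield L))}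
  (w : UnitaryGroup.PlacesOver L v) (hw : IsCMField.complexConj L • w.1 = w.1)

omit [IsCMField L] in
/-- Every scalar of `L_w` is the `w`-component of an element of `L ⊗ L⁺_v = Π_{w′ ∣ v} L_{w′}` (extension by zero). [cite: Jacobowitz1962, §3 Thm. 3.1] -/
theorem exists_localRing_apply_eq (x : w.1.adicCompletion L) : ∃ X : UnitaryGroup.LocalRing L v, X w = x := by
  refine ⟨fun w' => if h : w' = w then h ▸ x else 0, ?_⟩
  exact dif_pos rfl

include hw in
/-- Two elements of `Π_{w′ ∣ v} L_{w′}` agree iff they agree at the non-split place `w` (★ `PlacesOver.eq_of_smul_eq`: `w` is the only place above `v`).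
[cite: Jacobowitz1962, §3 Thm. 3.1] -/
theorem localRing_eq_of_apply_eq {X Y : UnitaryGroup.LocalRing L v} (h : X w = Y w) : X = Y := by
  funext w'
  obtain rfl : w' = w := PlacesOver.eq_of_smul_eq (IsCMField.complexConj L) (IsCMField.complexConj_ne_one L) w hw w'
  exact h

include hw in
/-- A `σ_w`-fixed scalar of `L_w` lifts to a `(c ⊗ 1)`-fixed element of `Π_{w′ ∣ v} L_{w′}` at a non-split place. [cite: Jacobowitz1962, §3 Thm. 3.1] -/
theorem exists_localRing_apply_eq_of_map_eq {x : w.1.adicCompletion L} (hx : galAdicCompletionMap (L := L) (IsCMField.complexConj L) hw x = x) :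
    ∃ X : UnitaryGroup.LocalRing L v, X w = x ∧ UnitaryGroup.conjLocal L (IsCMField.complexConj L) v X = X := by
  obtain ⟨X, hX⟩ := exists_localRing_apply_eq L w x
  refine ⟨X, hX, localRing_eq_of_apply_eq L w hw ?_⟩
  rw [conjLocal_apply_eq_of_smul_eq (IsCMField.complexConj L) (IsCMField.complexConj_ne_one L) v w hw X, hX, hx]

include hw in
/-- **THE ENTRIES OF `ᵗ(c ⊗ 1)(T) · Φ₃ · T` AT THE NON-SPLIT PLACE `w` ARE THE `Φ₃`-PRODUCTS OF THE COLUMNS OF `T_w`**: for `T ∈ GL₃(Π_{w′} L_{w′})`,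
`(ᵗ(c⊗1)(T) Φ₃ T)_{ij}(w) = pairing σ_w Φ₃ (col_i T_w) (col_j T_w)`. [cite: Jacobowitz1962, §3 Thm. 3.1] -/
theorem formCongr_antidiagOne_apply_apply (T : GL (Fin 3) (UnitaryGroup.LocalRing L v)) (i j : Fin 3) :
    formCongr (UnitaryGroup.conjLocal L (IsCMField.complexConj L) v) T
        (Matrix.of fun a b : Fin 3 => if a.val + b.val + 1 = 3 then (1 : UnitaryGroup.LocalRing L v) else 0) i j w =
      pairing (galAdicCompletionMap (L := L) (IsCMField.complexConj L) hw) ((StdForm.antidiagonal 3).over (w.1.adicCompletion L))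
        (fun a => (T : Matrix (Fin 3) (Fin 3) (UnitaryGroup.LocalRing L v)) a i w) (fun a => (T : Matrix (Fin 3) (Fin 3) (UnitaryGroup.LocalRing L v)) a j w) := by
  rw [← antidiagOne_eq_over, pairing_apply]
  simp only [formCongr, Matrix.mul_apply, Matrix.transpose_apply, Matrix.map_apply, Matrix.of_apply, Finset.sum_apply, Pi.mul_apply,
    Finset.sum_mul]
  rw [Finset.sum_comm]
  refine Finset.sum_congr rfl fun a _ => Finset.sum_congr rfl fun b _ => ?_
  rw [conjLocal_apply_eq_of_smul_eq (IsCMField.complexConj L) (IsCMField.complexConj_ne_one L) v w hw]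
  congr 2
  split_ifs <;> rfl

/-! ## §3  Frames with prescribed norm classes (Jacobowitz) and the four-frame family -/

include hw in
/-- **A `Φ₃`-ORTHOGONAL FRAME WITH PRESCRIBED NORMS** (Jacobowitz, rank 3, at a non-split place): for `σ_w`-fixed non-zero `n₁, n₂ ∈ L_w` there is a `Φ₃`-orthogonal frame
`(g₀, g₁, g₂)` of `L_w³` with `N(g₀) = n₁`, `N(g₁) = n₂`, `N(g₂) = −(n₁n₂)⁻¹` — the columns of a `T` with `ᵗσ(T)·Φ₃·T = diag(n₁, n₂, −(n₁n₂)⁻¹)`, which exists because both forms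
have determinant `−1` (★ `exists_formCongr_eq_of_det_eq_mul_norm_three`). [cite: Jacobowitz1962, §3 Thm. 3.1] [cite: Rogawski1990, §3.6 pp. 31–32] -/
theorem exists_orthogonalFrame_of_map_eq {n₁ n₂ : w.1.adicCompletion L}
    (h₁ : galAdicCompletionMap (L := L) (IsCMField.complexConj L) hw n₁ = n₁) (h₂ : galAdicCompletionMap (L := L) (IsCMField.complexConj L) hw n₂ = n₂)
    (h₁0 : n₁ ≠ 0) (h₂0 : n₂ ≠ 0) :
    ∃ g : Fin 3 → (Fin 3 → w.1.adicCompletion L),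
      (∀ i j : Fin 3, i ≠ j → pairing (galAdicCompletionMap (L := L) (IsCMField.complexConj L) hw) ((StdForm.antidiagonal 3).over (w.1.adicCompletion L)) (g i) (g j) = 0) ∧
      (∀ i : Fin 3, pairing (galAdicCompletionMap (L := L) (IsCMField.complexConj L) hw) ((StdForm.antidiagonal 3).over (w.1.adicCompletion L)) (g i) (g i) =
        (![n₁, n₂, -(n₁ * n₂)⁻¹] : Fin 3 → w.1.adicCompletion L) i) := by
  set σw := galAdicCompletionMap (L := L) (IsCMField.complexConj L) hw with hσw
  set cL := UnitaryGroup.conjLocal L (IsCMField.complexConj L) v with hcL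
  -- the third norm
  have h₃ : σw (-(n₁ * n₂)⁻¹) = -(n₁ * n₂)⁻¹ := by rw [map_neg, map_inv₀, map_mul, h₁, h₂]
  have h₃0 : -(n₁ * n₂)⁻¹ ≠ 0 := neg_ne_zero.2 (inv_ne_zero (mul_ne_zero h₁0 h₂0))
  -- lift the three norms to `(c ⊗ 1)`-fixed elements of `Π_{w′} L_{w′}`
  obtain ⟨X₁, hX₁, hX₁c⟩ := exists_localRing_apply_eq_of_map_eq L w hw h₁
  obtain ⟨X₂, hX₂, hX₂c⟩ := exists_localRing_apply_eq_of_map_eq L w hw h₂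
  obtain ⟨X₃, hX₃, hX₃c⟩ := exists_localRing_apply_eq_of_map_eq L w hw h₃
  -- the two forms
  set G : Matrix (Fin 3) (Fin 3) (UnitaryGroup.LocalRing L v) := Matrix.of fun a b : Fin 3 => if a.val + b.val + 1 = 3 then (1 : UnitaryGroup.LocalRing L v) else 0 with hG_def
  set G' : Matrix (Fin 3) (Fin 3) (UnitaryGroup.LocalRing L v) := Matrix.diagonal ![X₁, X₂, X₃] with hG'_def
  have hGmap : (Matrix.of fun a b : Fin 3 => if a.val + b.val + 1 = 3 then (1 : L) else 0).map (algebraMap L (UnitaryGroup.LocalRing L v)) = G := by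
    refine Matrix.ext fun a b => ?_
    simp only [Matrix.map_apply, Matrix.of_apply, hG_def]
    by_cases h : a.val + b.val + 1 = 3
    · rw [if_pos h, if_pos h, map_one]
    · rw [if_neg h, if_neg h, map_zero]
  have hGdet : G.det = -1 := by rw [← hGmap]; exact det_antidiagOne_three_map L (algebraMap L (UnitaryGroup.LocalRing L v))
  have hG : (G.map cL)ᵀ = G := by
    refine Matrix.ext fun a b => ?_
    simp only [Matrix.transpose_apply, Matrix.map_apply, hG_def, Matrix.of_apply]
    by_cases h : a.val + b.val + 1 = 3
    · rw [if_pos h, if_pos (by omega), map_one]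
    · rw [if_neg h, if_neg (by omega), map_zero]
  have hd : (fun m => cL ((![X₁, X₂, X₃] : Fin 3 → UnitaryGroup.LocalRing L v) m)) = ![X₁, X₂, X₃] := by
    funext i
    fin_cases i
    · exact hX₁c
    · exact hX₂c
    · exact hX₃c
  have hG' : (G'.map cL)ᵀ = G' := by
    rw [hG'_def, Matrix.diagonal_map (map_zero cL), Matrix.diagonal_transpose, hd]
  have hprod : X₁ * X₂ * X₃ = -1 := by
    refine localRing_eq_of_apply_eq L w hw ?_
    rw [Pi.mul_apply, Pi.mul_apply, hX₁, hX₂, hX₃, Pi.neg_apply, Pi.one_apply, mul_neg, mul_inv_cancel₀ (mul_ne_zero h₁0 h₂0)]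
  have hG'det : G'.det = -1 := by
    rw [hG'_def, Matrix.det_diagonal, Fin.prod_univ_three]
    simp only [Matrix.cons_val_zero, Matrix.cons_val_one, Matrix.cons_val_two, Matrix.head_cons, Matrix.tail_cons]
    exact hprod
  have hGu : IsUnit G.det := by rw [hGdet]; exact isUnit_one.neg
  have hG'u : IsUnit G'.det := by rw [hG'det]; exact isUnit_one.neg
  have hdet : ∃ z : UnitaryGroup.LocalRing L v, IsUnit z ∧ G'.det = G.det * (cL z * z) :=
    ⟨1, isUnit_one, by rw [hG'det, hGdet, map_one, mul_one, mul_one]⟩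
  obtain ⟨δ, d, hcδ, hδ0, -, -⟩ := exists_cm_delta L
  obtain ⟨T, hT⟩ := exists_formCongr_eq_of_det_eq_mul_norm_three L v (IsCMField.complexConj L) hcδ hδ0 w hw hG hG' hGu hG'u hdet
  -- the columns of `T_w`
  refine ⟨fun j a => (T : Matrix (Fin 3) (Fin 3) (UnitaryGroup.LocalRing L v)) a j w, fun i j hij => ?_, fun i => ?_⟩
  · rw [← formCongr_antidiagOne_apply_apply L w hw T i j, hT, hG'_def, Matrix.diagonal_apply_ne _ hij, Pi.zero_apply]
  · rw [← formCongr_antidiagOne_apply_apply L w hw T i i, hT, hG'_def, Matrix.diagonal_apply_eq]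
    fin_cases i
    · simpa using hX₁
    · simpa using hX₂
    · simpa using hX₃

/-- The frame index takes values in `{±1}²` (H4). [cite: Rogawski1990, §4.9 p. 55] -/
theorem signPair_fst_eq_or_snd_eq (b : Fin 4) : ((signPair b).1 = 1 ∨ (signPair b).1 = -1) ∧ ((signPair b).2 = 1 ∨ (signPair b).2 = -1) := by
  fin_cases b <;> simp [signPair]

include hw in
/-- **FOUR-FRAME FAMILIES EXIST AT EVERY NON-SPLIT CM PLACE** (H7 `IsFourFrameFamily σ_w f` is inhabited): with `ε` a `σ_w`-fixed non-norm (★ (J3), the local norm index is two),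
frame `b ↦ (ε₁, ε₂)` is a `Φ₃`-orthogonal frame with norms `(n₁, n₂, −(n₁n₂)⁻¹)`, `n_i ∈ {1, ε}` of class `ε_i`, and the third class is `ω(−1)ε₁ε₂` by the multiplicativity
of `ω` (§1).  The first ∃-witness of `U1_Frames.stub_U1_fourFrameData` ∕ (D-CΔ) `FourFrameTransferFactor`. [cite: Jacobowitz1962, §3 Thm. 3.1]
[cite: Rogawski1990, §3.6 pp. 31–32; §4.9 p. 55] [cite: Serre1979, Ch. XIV §3] -/
theorem exists_isFourFrameFamily :
    ∃ f : Fin 4 → Fin 3 → (Fin 3 → w.1.adicCompletion L), IsFourFrameFamily (galAdicCompletionMap (L := L) (IsCMField.complexConj L) hw) f := by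
  set σw := galAdicCompletionMap (L := L) (IsCMField.complexConj L) hw with hσw
  -- the local norm index in `σ_w`-currency: a fixed non-norm `ε` and the dichotomy
  obtain ⟨ε, hσε, hε0, hεn, hdich⟩ : ∃ ε : w.1.adicCompletion L, σw ε = ε ∧ ε ≠ 0 ∧ (∀ z, z * σw z ≠ ε) ∧
      ∀ s, σw s = s → s ≠ 0 → (∃ z, z * σw z = s) ∨ ∃ z, z * σw z = ε * s :=
    Literature.NumberTheory.LocalFields.IsCMField.exists_fixed_nonnorm_dichotomy L
      (⟨w.1, w.2⟩ : Literature.NumberTheory.GaloisRepresentations.SemiLocal.Place ↥(maximalRealSubfield L) L v) hw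
  have hεn' : ¬ ∃ z, z * σw z = ε := fun ⟨z, hz⟩ => hεn z hz
  have hσ1 : σw (-1) = -1 := by rw [map_neg, map_one]
  -- the representative of a class `s ∈ {±1}`
  have hrep : ∀ s : ℤ, s = 1 ∨ s = -1 → ∃ n : w.1.adicCompletion L, σw n = n ∧ n ≠ 0 ∧ normSign σw n = s := by
    rintro s (rfl | rfl)
    · exact ⟨1, map_one σw, one_ne_zero, by rw [normSign_one]⟩
    · exact ⟨ε, hσε, hε0, by rw [normSign_of_not_isNorm σw hεn']⟩
  -- one frame per index
  have hframe : ∀ b : Fin 4, ∃ g : Fin 3 → (Fin 3 → w.1.adicCompletion L),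
      (∀ i j : Fin 3, i ≠ j → pairing σw ((StdForm.antidiagonal 3).over (w.1.adicCompletion L)) (g i) (g j) = 0) ∧
      (∀ i : Fin 3, pairing σw ((StdForm.antidiagonal 3).over (w.1.adicCompletion L)) (g i) (g i) ≠ 0) ∧
      normSign σw (pairing σw ((StdForm.antidiagonal 3).over (w.1.adicCompletion L)) (g 0) (g 0)) = (signPair b).1 ∧
      normSign σw (pairing σw ((StdForm.antidiagonal 3).over (w.1.adicCompletion L)) (g 1) (g 1)) = (signPair b).2 ∧
      normSign σw (pairing σw ((StdForm.antidiagonal 3).over (w.1.adicCompletion L)) (g 2) (g 2)) = normSign σw (-1) * (signPair b).1 * (signPair b).2 := by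
    intro b
    obtain ⟨hb1, hb2⟩ := signPair_fst_eq_or_snd_eq b
    obtain ⟨n₁, hσ₁, h₁0, hω₁⟩ := hrep _ hb1
    obtain ⟨n₂, hσ₂, h₂0, hω₂⟩ := hrep _ hb2
    obtain ⟨g, hgo, hgn⟩ := exists_orthogonalFrame_of_map_eq L w hw hσ₁ hσ₂ h₁0 h₂0
    have hn0 : ∀ i : Fin 3, (![n₁, n₂, -(n₁ * n₂)⁻¹] : Fin 3 → w.1.adicCompletion L) i ≠ 0 := by
      intro i
      fin_cases i
      · exact h₁0
      · exact h₂0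
      · exact neg_ne_zero.2 (inv_ne_zero (mul_ne_zero h₁0 h₂0))
    refine ⟨g, hgo, fun i => by rw [hgn i]; exact hn0 i, ?_, ?_, ?_⟩
    · rw [hgn 0]; exact hω₁
    · rw [hgn 1]; exact hω₂
    · rw [hgn 2, ← hω₁, ← hω₂]
      change normSign σw (-(n₁ * n₂)⁻¹) = _
      have h12 : σw (n₁ * n₂) = n₁ * n₂ := by rw [map_mul, hσ₁, hσ₂]
      have h12i : σw (n₁ * n₂)⁻¹ = (n₁ * n₂)⁻¹ := by rw [map_inv₀, h12]
      rw [neg_eq_neg_one_mul, normSign_mul_of_dichotomy σw hσε hεn' hdich hσ1 h12i (neg_ne_zero.2 one_ne_zero) (inv_ne_zero (mul_ne_zero h₁0 h₂0)),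
        normSign_inv_of_map_eq σw h12 (mul_ne_zero h₁0 h₂0), normSign_mul_of_dichotomy σw hσε hεn' hdich hσ₁ hσ₂ h₁0 h₂0, mul_assoc]
  choose f hf using hframe
  exact ⟨f, fun b => ⟨(hf b).1, (hf b).2.1, (hf b).2.2.1, (hf b).2.2.2.1, (hf b).2.2.2.2⟩⟩

end CM

end Literature.NumberTheory.Automorphic.UnitaryThreeFourFrame

end
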